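import Literature.Probability.LatticeModels.KasteleynMatrix
import Literature.Probability.LatticeModels.LatticeLoopEnclosure
import Mathlib.GroupTheory.Perm.Cycle.Factors
import Mathlib.Data.ZMod.Basic
import HarnessLib

/-!
# Proof of Kasteleyn's theorem with deleted dimers (`Kenyon1997_prop5`)

Topic `Literature/Probability/LatticeModels`. This file discharges the named fact
`Kenyon1997_prop5` of `KasteleynMatrix.lean` (R. Kenyon, *Local statistics of lattice dimers*,
AIHP 33 (1997), Prop. 5 with Thm 2, domino version): for `G` on `V` the 1-skeleton of a simply
connected union of lattice faces, `V` balanced, and `S ⊆ V` carrying a perfect matching of `G`,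
`‖det K_{V ∖ S}‖ = (#perfect matchings of G on V ∖ S)²`, `K` the Kasteleyn matrix (weight `1` on
horizontal and `i` on vertical bonds).

## The printed proof and what is formalised

Kenyon 1997 proves Prop. 5 from Thm 2 (Kasteleyn's theorem for the simply connected `H'`) by
a cofactor expansion, and for Thm 2 writes (p. 5): "each nonzero term in the sum corresponds to a
matching. One need only check (and this is the most interesting part, although we won't do it
here) that each term has the same sign", referring to Kasteleyn. We supply that step following
Kenyon, *Lectures on dimers* (2009), §3.4, proof of Thm 2, and §3.3, Lemma 1, directly for the
region `U = V ∖ S` with its evenly matched holes (which avoids the cofactor bookkeeping; the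
argument is otherwise the printed one):

1. `|det K_U| = |det B'|²` for the black-to-white block `B'` (`norm_det_kasteleynMatrix_eq_sq`,
   already in `KasteleynMatrix.lean`), and `det B' = ∑_σ sgn σ ∏_b B(σ b, e b)`; the non-zero
   terms are the permutations `σ` with `σ b ∼ e b` for all black `b`, in bijection with the
   perfect matchings (`Kasteleyn.card_filter_adjAll`, `Kasteleyn.perfectMatchingCount_eq_card`, through the partner maps of
   `PerfectMatchingCount.lean`), each of modulus `1`.
2. **Sign coherence** (`Kasteleyn.sign_eq_prod`): with the reference identification `e` itself a
   matching, `sgn σ = ∏_b K(b, e b) conj K(σ b, e b)` for every such `σ`. By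
   `Equiv.Perm.cycle_induction_on` it suffices to treat a cycle `σ` (Kenyon 2009: "we are
   changing the permutation by a `k`-cycle"); the superposition cycle
   `b₀, e b₀, σ b₀, e σ b₀, …` is a simple closed lattice walk of length `2k`
   (`Kasteleyn.cycleWalk`), and Kasteleyn's sign lemma in winding form
   (`ClosedWalk.altProd_eq_of_even`, `LatticeLoopWinding.lean`: the alternating product is
   `(-1)^{k+1} = sgn` of a `k`-cycle) applies once the winding numbers of the lattice points off
   the cycle have even sum ("`ℓ` even since interior points are matched among themselves"):
   points with non-zero winding number are corners of enclosed faces, which lie in `F` because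
   `⋃ F` is simply connected (`ClosedWalk.W_eq_zero_of_ctr_notMem`, `LatticeLoopEnclosure.lean`),
   hence in `V`; off the cycle, `V` is paired by the matching of `S` and the reference matching
   `e`, lattice neighbours off the cycle having equal winding numbers (`ClosedWalk.W_eq_of_notMem`).
3. Hence `det B' = (#matchings) · (common unit term)` and `‖det K_U‖ = (#matchings)²`; the
   unbalanced and the unmatchable cases give `0 = 0`.

## References

* R. Kenyon, *Local statistics of lattice dimers*, Ann. Inst. H. Poincaré Probab. Statist. 33
  (1997) 591–618, §2.1 Thm 2, §3 Prop. 5. [Kenyon1997]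
* R. Kenyon, *Lectures on dimers*, IAS/Park City Math. Ser. 16 (2009), §3.3 Lemma 1, §3.4
  Thm 2. [Kenyon2009]
* P. W. Kasteleyn, Physica 27 (1961) 1209–1225; H. N. V. Temperley, M. E. Fisher, Phil. Mag. 6
  (1961) 1061–1063.
-/

noncomputable section

open scoped Classical

namespace Literature.Probability.LatticeModels

open Finset Matrix Literature.Topology.PlaneTopology

namespace Kasteleyn

/-! ### Sites as integer pairs -/

/-- The site `x ∈ ℤ²` as a pair of integers. [folklore] -/
def sitePair (x : Site 2) : ℤ × ℤ := (x 0, x 1)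

/-- `sitePair` is injective. [folklore] -/
theorem sitePair_injective : Function.Injective sitePair := by
  intro x y h
  simp only [sitePair, Prod.mk.injEq] at h
  funext i
  fin_cases i
  · exact h.1
  · exact h.2

/-- `toC ∘ sitePair` is the embedding `Site.toComplex`. [folklore] -/
theorem toC_sitePair (x : Site 2) : toC (sitePair x) = Site.toComplex x := rfl

/-- Lattice neighbours of `ℤ²` are `RectLoop`-adjacent pairs. [folklore] -/
theorem adj_sitePair {x y : Site 2} (h : (zdGraph 2).Adj x y) : RectLoop.Adj (sitePair x) (sitePair y) := by
  rw [adj_iff]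
  obtain ⟨i, h | h⟩ := (zdGraph_adj_iff x y).1 h
  · fin_cases i
    · left; simp [sitePair, h]
    · right; left; simp [sitePair, h]
  · fin_cases i
    · right; right; left; simp [sitePair, h]
    · right; right; right; simp [sitePair, h]

/-- For lattice neighbours, Kasteleyn's flat weight is `i` iff the bond is vertical (same first
coordinate), else `1`. [cite: Kenyon1997, §3 ¶1] -/
theorem kasteleynWeight_eq_ite {x y : Site 2} (h : (zdGraph 2).Adj x y) :
    kasteleynWeight x y = if y 0 = x 0 then Complex.I else 1 := by
  rcases Fin.exists_fin_two.1 ((zdGraph_adj_iff x y).1 h) with h0 | h1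
  · have hne : y 0 ≠ x 0 := by
      rcases h0 with h0 | h0
      · have := congrFun h0 0; simp at this; omega
      · have := congrFun h0 0; simp at this; omega
    rw [kasteleynWeight, if_pos h0, if_neg hne]
  · have hy0 : y 0 = x 0 := by
      rcases h1 with h1 | h1
      · have := congrFun h1 0; simpa using this
      · have := congrFun h1 0; simp at this; omega
    have hne : ¬ (y = x + Pi.single 0 1 ∨ x = y + Pi.single 0 1) := by
      rintro (h0 | h0)
      · have := congrFun h0 0; simp at this; omega
      · have := congrFun h0 0; simp at this; omega
    rw [kasteleynWeight, if_neg hne, if_pos h1, if_pos hy0]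

/-- The weight of a lattice bond times its conjugate is `1`. [folklore] -/
theorem kasteleynWeight_mul_conj {x y : Site 2} (h : (zdGraph 2).Adj x y) :
    kasteleynWeight x y * (starRingEnd ℂ) (kasteleynWeight x y) = 1 := by
  rw [Complex.mul_conj, Complex.normSq_eq_norm_sq, norm_kasteleynWeight_of_adj h]
  simp

/-! ### Black-to-white adjacency bijections and perfect matchings -/

variable (G : SimpleGraph (Site 2)) (U : Finset (Site 2))

/-- The **black-to-white adjacency bijections** of `G` on `U`: bijections `β` from the black to
the white sites of `U` with `b ∼ β b` for every black `b` — the non-zero terms of the expansion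
of `det B` (Kenyon 1997, proof of Thm 2: "each nonzero term in the sum corresponds to a
matching"). [cite: Kenyon1997, Thm 2 (proof sketch)] -/
abbrev BWBij : Type :=
  {β : blackPart U ≃ whitePart U // ∀ b : blackPart U, G.Adj (b : Site 2) ((β b : whitePart U) : Site 2)}

variable {G U}

section Partner

/-- The partner map of a black-to-white adjacency bijection: `b ↦ β b`, `w ↦ β⁻¹ w`. [folklore] -/
def partnerOfBW (β : BWBij G U) (x : ↥(U : Set (Site 2))) : ↥(U : Set (Site 2)) :=
  if h : IsWhite (x : Site 2) then
    ⟨(β.1.symm ⟨x, mem_whitePart.2 ⟨x.2, h⟩⟩ : Site 2),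
      (mem_blackPart.1 (β.1.symm ⟨x, mem_whitePart.2 ⟨x.2, h⟩⟩).2).1⟩
  else
    ⟨(β.1 ⟨x, mem_blackPart.2 ⟨x.2, h⟩⟩ : Site 2), (mem_whitePart.1 (β.1 ⟨x, mem_blackPart.2 ⟨x.2, h⟩⟩).2).1⟩

/-- The partner of a white site is black, namely `β⁻¹` of it. [folklore] -/
theorem partnerOfBW_of_isWhite (β : BWBij G U) (x : ↥(U : Set (Site 2))) (h : IsWhite (x : Site 2)) :
    (partnerOfBW β x : Site 2) = β.1.symm ⟨x, mem_whitePart.2 ⟨x.2, h⟩⟩ := by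
  simp [partnerOfBW, h]

/-- The partner of a black site is white, namely `β` of it. [folklore] -/
theorem partnerOfBW_of_not_isWhite (β : BWBij G U) (x : ↥(U : Set (Site 2)))
    (h : ¬ IsWhite (x : Site 2)) :
    (partnerOfBW β x : Site 2) = β.1 ⟨x, mem_blackPart.2 ⟨x.2, h⟩⟩ := by
  simp [partnerOfBW, h]

/-- `partnerOfBW β` is an adjacency-respecting involution. [folklore] -/
theorem partnerOfBW_spec (β : BWBij G U) (x : ↥(U : Set (Site 2))) :
    (G.induce (U : Set (Site 2))).Adj x (partnerOfBW β x) ∧ partnerOfBW β (partnerOfBW β x) = x := by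
  by_cases h : IsWhite (x : Site 2)
  · constructor
    · rw [SimpleGraph.induce_adj, partnerOfBW_of_isWhite β x h]
      have := β.2 (β.1.symm ⟨x, mem_whitePart.2 ⟨x.2, h⟩⟩)
      rw [Equiv.apply_symm_apply] at this
      exact this.symm
    · apply Subtype.ext
      have hb' : ¬ IsWhite ((partnerOfBW β x : ↥(U : Set (Site 2))) : Site 2) := by
        rw [partnerOfBW_of_isWhite β x h]
        exact (mem_blackPart.1 (β.1.symm ⟨x, mem_whitePart.2 ⟨x.2, h⟩⟩).2).2
      rw [partnerOfBW_of_not_isWhite β _ hb']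
      have : (⟨(partnerOfBW β x : Site 2), mem_blackPart.2 ⟨(partnerOfBW β x).2, hb'⟩⟩ :
          blackPart U) = β.1.symm ⟨x, mem_whitePart.2 ⟨x.2, h⟩⟩ :=
        Subtype.ext (partnerOfBW_of_isWhite β x h)
      rw [this, Equiv.apply_symm_apply]
  · constructor
    · rw [SimpleGraph.induce_adj, partnerOfBW_of_not_isWhite β x h]
      exact β.2 ⟨x, mem_blackPart.2 ⟨x.2, h⟩⟩
    · apply Subtype.ext
      have hw' : IsWhite ((partnerOfBW β x : ↥(U : Set (Site 2))) : Site 2) := by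
        rw [partnerOfBW_of_not_isWhite β x h]
        exact (mem_whitePart.1 (β.1 ⟨x, mem_blackPart.2 ⟨x.2, h⟩⟩).2).2
      rw [partnerOfBW_of_isWhite β _ hw']
      have : (⟨(partnerOfBW β x : Site 2), mem_whitePart.2 ⟨(partnerOfBW β x).2, hw'⟩⟩ :
          whitePart U) = β.1 ⟨x, mem_blackPart.2 ⟨x.2, h⟩⟩ :=
        Subtype.ext (partnerOfBW_of_not_isWhite β x h)
      rw [this, Equiv.symm_apply_apply]

/-- The black-to-white bijection of a partner map: `b ↦` its partner (white by bipartiteness).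
[folklore] -/
def bwOfPartner (hbip : ∀ ⦃x y : Site 2⦄, x ∈ U → y ∈ U → G.Adj x y → (IsWhite x ↔ ¬ IsWhite y))
    (f : {f : ↥(U : Set (Site 2)) → ↥(U : Set (Site 2)) //
      ∀ v, (G.induce (U : Set (Site 2))).Adj v (f v) ∧ f (f v) = v}) : BWBij G U :=
  have hcol : ∀ v : ↥(U : Set (Site 2)), IsWhite (v : Site 2) ↔ ¬ IsWhite (f.1 v : Site 2) :=
    fun v => hbip v.2 (f.1 v).2 (SimpleGraph.induce_adj.1 (f.2 v).1)
  ⟨⟨fun b => ⟨f.1 ⟨b, (mem_blackPart.1 b.2).1⟩, mem_whitePart.2 ⟨(f.1 _).2, by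
        by_contra hw
        exact (mem_blackPart.1 b.2).2 ((hcol _).2 hw)⟩⟩,
    fun w => ⟨f.1 ⟨w, (mem_whitePart.1 w.2).1⟩, mem_blackPart.2 ⟨(f.1 _).2,
        (hcol _).1 (mem_whitePart.1 w.2).2⟩⟩,
    fun b => Subtype.ext (by simpa using congrArg Subtype.val (f.2 ⟨b, (mem_blackPart.1 b.2).1⟩).2),
    fun w => Subtype.ext (by simpa using congrArg Subtype.val (f.2 ⟨w, (mem_whitePart.1 w.2).1⟩).2)⟩,
    fun b => SimpleGraph.induce_adj.1 (f.2 ⟨b, (mem_blackPart.1 b.2).1⟩).1⟩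

/-- **Partner maps are black-to-white adjacency bijections** (for `G` bipartite on `U` in the
chessboard colouring). [folklore] -/
def partnerEquivBW (hbip : ∀ ⦃x y : Site 2⦄, x ∈ U → y ∈ U → G.Adj x y → (IsWhite x ↔ ¬ IsWhite y)) :
    {f : ↥(U : Set (Site 2)) → ↥(U : Set (Site 2)) //
      ∀ v, (G.induce (U : Set (Site 2))).Adj v (f v) ∧ f (f v) = v} ≃ BWBij G U where
  toFun := bwOfPartner hbip
  invFun β := ⟨partnerOfBW β, partnerOfBW_spec β⟩
  left_inv f := by
    apply Subtype.ext
    funext x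
    apply Subtype.ext
    by_cases h : IsWhite (x : Site 2)
    · show (partnerOfBW (bwOfPartner hbip f) x : Site 2) = f.1 x
      rw [partnerOfBW_of_isWhite _ x h]
      rfl
    · show (partnerOfBW (bwOfPartner hbip f) x : Site 2) = f.1 x
      rw [partnerOfBW_of_not_isWhite _ x h]
      rfl
  right_inv β := by
    apply Subtype.ext
    apply Equiv.ext
    intro b
    apply Subtype.ext
    show (partnerOfBW β ⟨b, (mem_blackPart.1 b.2).1⟩ : Site 2) = β.1 b
    rw [partnerOfBW_of_not_isWhite β _ (mem_blackPart.1 b.2).2]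

/-- **The number of perfect matchings is the number of black-to-white adjacency bijections.**
[cite: Kenyon1997, Thm 2 (proof sketch)] -/
theorem perfectMatchingCount_eq_card
    (hbip : ∀ ⦃x y : Site 2⦄, x ∈ U → y ∈ U → G.Adj x y → (IsWhite x ↔ ¬ IsWhite y)) :
    perfectMatchingCount G (U : Set (Site 2)) = Nat.card (BWBij G U) := by
  rw [perfectMatchingCount_def]
  exact Nat.card_congr ((perfectMatchingEquivPartner _).trans (partnerEquivBW hbip))

end Partner

/-! ### The determinant of the black block as a sum over adjacency bijections -/

section Det

variable {G : SimpleGraph (Site 2)} {U : Finset (Site 2)}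

/-- All blacks `σ b` are `G`-adjacent to `e b`: the permutation `σ` gives a non-zero term of
`det B'`. [cite: Kenyon1997, Thm 2 (proof sketch)] -/
def AdjAll (G : SimpleGraph (Site 2)) (e : blackPart U ≃ whitePart U) : Equiv.Perm (blackPart U) → Prop :=
  fun σ => ∀ b : blackPart U, G.Adj ((σ b : blackPart U) : Site 2) ((e b : whitePart U) : Site 2)

/-- The unit part `∏_b K(σ b, e b)` of the term of `σ`. [cite: Kenyon1997, Thm 2 (proof sketch)] -/
def omega (e : blackPart U ≃ whitePart U) (σ : Equiv.Perm (blackPart U)) : ℂ :=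
  ∏ b : blackPart U, kasteleynWeight ((σ b : blackPart U) : Site 2) ((e b : whitePart U) : Site 2)

/-- The term of `σ` in `det B'`: `omega e σ` if all pairs are adjacent, `0` otherwise. [folklore] -/
theorem prod_kasteleynBW_eq (e : blackPart U ≃ whitePart U) (σ : Equiv.Perm (blackPart U)) :
    ∏ b : blackPart U, kasteleynBW G U (σ b) (e b) = if AdjAll G e σ then omega e σ else 0 := by
  split_ifs with h
  · exact Finset.prod_congr rfl fun b _ => by rw [kasteleynBW_apply, if_pos (h b)]
  · simp only [AdjAll, not_forall] at h
    obtain ⟨b, hb⟩ := h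
    exact Finset.prod_eq_zero (Finset.mem_univ b) (by rw [kasteleynBW_apply, if_neg hb])

/-- **`det B' = ∑_{σ adjacent} sgn σ · ∏_b K(σ b, e b)`** (Kenyon 1997, (detB)). [cite: Kenyon1997, Thm 2 (proof sketch)] -/
theorem det_submatrix_eq (e : blackPart U ≃ whitePart U) :
    ((kasteleynBW G U).submatrix id e).det =
      ∑ σ ∈ (Finset.univ : Finset (Equiv.Perm (blackPart U))).filter (AdjAll G e),
        ((Equiv.Perm.sign σ : ℤ) : ℂ) * omega e σ := by
  rw [Matrix.det_apply, Finset.sum_filter]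
  refine Finset.sum_congr rfl fun σ _ => ?_
  simp only [Matrix.submatrix_apply, id]
  rw [prod_kasteleynBW_eq, Units.smul_def, zsmul_eq_mul]
  split_ifs <;> simp

/-- The unit part has modulus `1` (on lattice bonds). [folklore] -/
theorem norm_omega (e : blackPart U ≃ whitePart U) (σ : Equiv.Perm (blackPart U))
    (h : ∀ b : blackPart U, (zdGraph 2).Adj ((σ b : blackPart U) : Site 2) ((e b : whitePart U) : Site 2)) :
    ‖omega e σ‖ = 1 := by
  rw [omega, norm_prod]
  exact Finset.prod_eq_one fun b _ => norm_kasteleynWeight_of_adj (h b)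

/-- **Adjacent permutations are adjacency bijections**: `σ ↦ e ∘ σ⁻¹`. [cite: Kenyon1997, Thm 2 (proof sketch)] -/
def adjAllEquivBW (e : blackPart U ≃ whitePart U) :
    {σ : Equiv.Perm (blackPart U) // AdjAll G e σ} ≃ BWBij G U where
  toFun σ := ⟨σ.1.symm.trans e, fun b => by
    have := σ.2 (σ.1.symm b)
    rwa [Equiv.apply_symm_apply] at this⟩
  invFun β := ⟨e.trans β.1.symm, fun b => by
    have := β.2 (β.1.symm (e b))
    rwa [Equiv.apply_symm_apply] at this⟩
  left_inv σ := by
    apply Subtype.ext; apply Equiv.ext; intro b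
    simp
  right_inv β := by
    apply Subtype.ext; apply Equiv.ext; intro b
    simp

/-- The number of adjacent permutations is the number of adjacency bijections. [folklore] -/
theorem card_filter_adjAll (e : blackPart U ≃ whitePart U) :
    ((Finset.univ : Finset (Equiv.Perm (blackPart U))).filter (AdjAll G e)).card =
      Nat.card (BWBij G U) := by
  rw [← Fintype.card_subtype, Nat.card_eq_fintype_card]
  exact Fintype.card_congr (adjAllEquivBW e)

/-- **From sign coherence to Kasteleyn's count.** If `e` is itself adjacent and every adjacent
`σ` satisfies `sgn σ · ∏_b K(σ b, e b) = ∏_b K(b, e b)`, then `‖det B'‖` is the number of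
adjacency bijections. [cite: Kenyon1997, Thm 2 (proof sketch)] -/
theorem norm_det_submatrix_of_coherent (e : blackPart U ≃ whitePart U)
    (hzd : ∀ b : blackPart U, (zdGraph 2).Adj ((b : blackPart U) : Site 2) ((e b : whitePart U) : Site 2))
    (hcoh : ∀ σ : Equiv.Perm (blackPart U), AdjAll G e σ →
      ((Equiv.Perm.sign σ : ℤ) : ℂ) * omega e σ = omega e 1) :
    ‖((kasteleynBW G U).submatrix id e).det‖ = Nat.card (BWBij G U) := by
  rw [det_submatrix_eq, Finset.sum_congr rfl fun σ hσ => hcoh σ (Finset.mem_filter.1 hσ).2,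
    Finset.sum_const, card_filter_adjAll, nsmul_eq_mul, norm_mul, norm_omega e 1 (by simpa using hzd)]
  simp

end Det

/-! ### Face skeleta: step segments and face centres -/

section Skeleton

variable {G : SimpleGraph (Site 2)} {V F : Finset (Site 2)}

/-- The corners of a lattice face lie on its closed square. [folklore] -/
theorem toComplex_mem_closedFace_of_mem_latticeFace {a z : Site 2} (hz : z ∈ latticeFace a) :
    toC (sitePair z) ∈ closedFace a := by
  simp only [latticeFace, Finset.mem_insert, Finset.mem_singleton] at hz
  simp only [closedFace, Set.mem_setOf_eq, toC_re, toC_im, sitePair]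
  rcases hz with rfl | rfl | rfl | rfl <;> simp

/-- **The step segments of `G` on `V` lie in the face union**: an edge of a face skeleton is a
side of a face of `F`. [cite: Kenyon1997, §2.1 (definition of a simply connected subgraph)] -/
theorem segment_subset_faceUnion (hF : IsFaceSkeleton G V F) {x y : Site 2} (hx : x ∈ V) (hy : y ∈ V)
    (h : G.Adj x y) : segment ℝ (toC (sitePair x)) (toC (sitePair y)) ⊆ faceUnion F := by
  obtain ⟨-, a, ha, hxa, hya⟩ := (hF.adj_iff hx hy).1 h
  intro z hz
  exact mem_faceUnion.2 ⟨a, ha, (convex_closedFace a).segment_subset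
    (toComplex_mem_closedFace_of_mem_latticeFace hxa) (toComplex_mem_closedFace_of_mem_latticeFace hya) hz⟩

/-- The only closed face containing the centre of the face `u` is the face `u`. [folklore] -/
theorem sitePair_eq_of_ctr_mem_closedFace {a : Site 2} {u : ℤ × ℤ} (h : ctr u ∈ closedFace a) :
    sitePair a = u := by
  simp only [closedFace, Set.mem_setOf_eq, ctr_re, ctr_im] at h
  obtain ⟨h1, h2, h3, h4⟩ := h
  have e1 : (a 0 : ℝ) < u.1 + 1 := by linarith
  have e2 : (u.1 : ℝ) < a 0 + 1 := by linarith
  have e3 : (a 1 : ℝ) < u.2 + 1 := by linarith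
  have e4 : (u.2 : ℝ) < a 1 + 1 := by linarith
  have e1' : a 0 < u.1 + 1 := by exact_mod_cast e1
  have e2' : u.1 < a 0 + 1 := by exact_mod_cast e2
  have e3' : a 1 < u.2 + 1 := by exact_mod_cast e3
  have e4' : u.2 < a 1 + 1 := by exact_mod_cast e4
  exact Prod.ext (by simp only [sitePair]; omega) (by simp only [sitePair]; omega)

/-- A face of `F` has its lower-left corner in `V`. [folklore] -/
theorem mem_of_mem_faces (hF : IsFaceSkeleton G V F) {a : Site 2} (ha : a ∈ F) : a ∈ V := by
  rw [hF.eq_biUnion, Finset.mem_biUnion]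
  exact ⟨a, ha, by simp [latticeFace]⟩

/-- **Enclosed faces belong to `F`.** For a closed walk along `G`-edges of a face skeleton with
simply connected face union, every face with non-zero winding number is a face of `F`; in
particular its lower-left corner is a site of `V`. [folklore] -/
theorem exists_mem_of_W_ne_zero (hF : IsFaceSkeleton G V F) (hsc : IsSimplyConnected (faceUnion F))
    {n : ℕ} (hn : 0 < n) (c : ClosedWalk n)
    (hc : ∀ j, ∃ x ∈ V, ∃ y ∈ V, G.Adj x y ∧ c.v j = sitePair x ∧ c.v (j + 1) = sitePair y)
    {u : ℤ × ℤ} (hu : c.W u ≠ 0) : ∃ a ∈ V, sitePair a = u := by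
  by_contra hne
  apply hu
  refine c.W_eq_zero_of_ctr_notMem hn hsc (fun j => ?_) fun hmem => ?_
  · obtain ⟨x, hx, y, hy, hxy, h1, h2⟩ := hc j
    rw [h1, h2]
    exact segment_subset_faceUnion hF hx hy hxy
  · obtain ⟨a, ha, hau⟩ := mem_faceUnion.1 hmem
    exact hne ⟨a, mem_of_mem_faces hF ha, sitePair_eq_of_ctr_mem_closedFace hau⟩

end Skeleton

/-! ### The superposition cycle of a cyclic permutation as a closed lattice walk -/

section Cycle

variable {G : SimpleGraph (Site 2)} {V S F : Finset (Site 2)}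
variable (e : blackPart (V \ S) ≃ whitePart (V \ S)) (σ : Equiv.Perm (blackPart (V \ S)))
  (b₀ : blackPart (V \ S))

/-- The vertices of the superposition cycle: `b₀, e b₀, σ b₀, e σ b₀, σ² b₀, …`. [cite: Kenyon2009, §3.4] -/
def cyc (i : ℕ) : ℤ × ℤ :=
  if i % 2 = 0 then sitePair (((σ ^ (i / 2)) b₀ : blackPart (V \ S)) : Site 2)
  else sitePair ((e ((σ ^ (i / 2)) b₀) : whitePart (V \ S)) : Site 2)

/-- Even vertices are black. [folklore] -/
theorem cyc_even (j : ℕ) : cyc e σ b₀ (2 * j) = sitePair (((σ ^ j) b₀ : blackPart (V \ S)) : Site 2) := by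
  simp only [cyc, Nat.mul_mod_right, if_true, Nat.mul_div_cancel_left j two_pos]

/-- Odd vertices are white. [folklore] -/
theorem cyc_odd (j : ℕ) : cyc e σ b₀ (2 * j + 1) = sitePair ((e ((σ ^ j) b₀) : whitePart (V \ S)) : Site 2) := by
  simp only [cyc]
  rw [if_neg (by omega), show (2 * j + 1) / 2 = j by omega]

variable {e σ b₀}

/-- Black sites of `V ∖ S` are sites of `V`. [folklore] -/
theorem mem_of_black (b : blackPart (V \ S)) : (b : Site 2) ∈ V :=
  (Finset.mem_sdiff.1 (mem_blackPart.1 b.2).1).1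

/-- White sites of `V ∖ S` are sites of `V`. [folklore] -/
theorem mem_of_white (w : whitePart (V \ S)) : (w : Site 2) ∈ V :=
  (Finset.mem_sdiff.1 (mem_whitePart.1 w.2).1).1

/-- A black and a white site differ. [folklore] -/
theorem black_ne_white (b : blackPart (V \ S)) (w : whitePart (V \ S)) : (b : Site 2) ≠ (w : Site 2) :=
  fun h => (mem_blackPart.1 b.2).2 (h ▸ (mem_whitePart.1 w.2).2)

variable (hF : IsFaceSkeleton G V F) (he : ∀ b : blackPart (V \ S), G.Adj (b : Site 2) ((e b : whitePart (V \ S)) : Site 2))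
  (hσc : σ.IsCycle) (hσ : AdjAll G e σ) (hb₀ : b₀ ∈ σ.support)

include hσc in
/-- `σ ^ #support = 1` for a cycle. [folklore] -/
theorem pow_card_support : σ ^ σ.support.card = 1 := by
  rw [← hσc.orderOf]; exact pow_orderOf_eq_one σ

/-- **The superposition cycle as a closed lattice walk** of period `2 · #support σ`. [cite: Kenyon2009, §3.4] -/
def cycleWalk : ClosedWalk (2 * σ.support.card) where
  v := cyc e σ b₀
  periodic i := by
    have h1 : (i + 2 * σ.support.card) % 2 = i % 2 := by omega
    have h2 : (i + 2 * σ.support.card) / 2 = i / 2 + σ.support.card := by omega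
    simp only [cyc, h1, h2, pow_add, pow_card_support hσc, mul_one]
  adj i := by
    obtain ⟨j, rfl | rfl⟩ := Nat.even_or_odd' i
    · rw [cyc_even, cyc_odd]
      exact adj_sitePair (hF.zdGraph_adj (mem_of_black _) (mem_of_white _) (he _))
    · rw [cyc_odd, show 2 * j + 1 + 1 = 2 * (j + 1) by ring, cyc_even, pow_succ', Equiv.Perm.mul_apply]
      exact adj_sitePair (hF.zdGraph_adj (mem_of_white _) (mem_of_black _) (hσ _).symm)

/-- The vertices of `cycleWalk`. [folklore] -/
theorem cycleWalk_v : (cycleWalk hF he hσc hσ (b₀ := b₀)).v = cyc e σ b₀ := rfl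

include hσc in
/-- `σ` is a cycle on its support. [folklore] -/
theorem isCycleOn_support : σ.IsCycleOn (σ.support : Set (blackPart (V \ S))) := by
  rw [Equiv.Perm.coe_support_eq_set_support]; exact hσc.isCycleOn

include hσc hb₀ in
/-- Powers of `σ` at `b₀` agree iff the exponents agree mod `#support`. [folklore] -/
theorem pow_apply_eq_iff {j j' : ℕ} : (σ ^ j) b₀ = (σ ^ j') b₀ ↔ j ≡ j' [MOD σ.support.card] :=
  (isCycleOn_support hσc).pow_apply_eq_pow_apply hb₀

include hb₀ in
/-- **The superposition cycle is simple.** [folklore] -/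
theorem cycleWalk_simple : (cycleWalk hF he hσc hσ (b₀ := b₀)).Simple := by
  refine ⟨fun i i' h => ?_⟩
  rw [cycleWalk_v] at h
  obtain ⟨j, rfl | rfl⟩ := Nat.even_or_odd' i <;> obtain ⟨j', rfl | rfl⟩ := Nat.even_or_odd' i'
  · rw [cyc_even, cyc_even] at h
    have h' := (pow_apply_eq_iff hσc hb₀).1 (Subtype.ext (sitePair_injective h))
    exact Nat.ModEq.mul_left' 2 h'
  · rw [cyc_even, cyc_odd] at h
    exact absurd (sitePair_injective h) (black_ne_white _ _)
  · rw [cyc_odd, cyc_even] at h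
    exact absurd (sitePair_injective h).symm (black_ne_white _ _)
  · rw [cyc_odd, cyc_odd] at h
    have h' := (pow_apply_eq_iff hσc hb₀).1 (e.injective (Subtype.ext (sitePair_injective h)))
    exact Nat.ModEq.add_right 1 (Nat.ModEq.mul_left' 2 h')

include hσc hb₀ in
/-- Every element of the support is `σ ^ j b₀` with `j < #support`. [folklore] -/
theorem exists_pow_eq_of_mem {b : blackPart (V \ S)} (hb : b ∈ σ.support) :
    ∃ j < σ.support.card, (σ ^ j) b₀ = b := by
  obtain ⟨i, hi⟩ := hσc.exists_pow_eq (Equiv.Perm.mem_support.1 hb₀) (Equiv.Perm.mem_support.1 hb)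
  refine ⟨i % σ.support.card, Nat.mod_lt _ (Finset.card_pos.2 ⟨b₀, hb₀⟩), ?_⟩
  rw [← hσc.orderOf, pow_mod_orderOf, hi]

/-- The sites on the superposition cycle: the support and its image under `e`. [folklore] -/
def cycSites (e : blackPart (V \ S) ≃ whitePart (V \ S)) (σ : Equiv.Perm (blackPart (V \ S))) : Finset (Site 2) :=
  σ.support.image (fun b : blackPart (V \ S) => (b : Site 2)) ∪
    σ.support.image (fun b : blackPart (V \ S) => ((e b : whitePart (V \ S)) : Site 2))

include hb₀ in
/-- The vertex set of the superposition cycle. [folklore] -/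
theorem mem_verts_cycleWalk_iff {u : ℤ × ℤ} :
    u ∈ (cycleWalk hF he hσc hσ (b₀ := b₀)).verts ↔ ∃ x ∈ cycSites e σ, sitePair x = u := by
  have hm : 0 < 2 * σ.support.card := by have := Finset.card_pos.2 ⟨b₀, hb₀⟩; omega
  rw [ClosedWalk.mem_verts_iff _ hm, cycleWalk_v]
  constructor
  · rintro ⟨i, rfl⟩
    obtain ⟨j, rfl | rfl⟩ := Nat.even_or_odd' i
    · refine ⟨_, Finset.mem_union_left _ (Finset.mem_image_of_mem _ ?_), (cyc_even e σ b₀ j).symm⟩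
      exact Equiv.Perm.pow_apply_mem_support.2 hb₀
    · refine ⟨_, Finset.mem_union_right _ (Finset.mem_image_of_mem _ ?_), (cyc_odd e σ b₀ j).symm⟩
      exact Equiv.Perm.pow_apply_mem_support.2 hb₀
  · rintro ⟨x, hx, rfl⟩
    rcases Finset.mem_union.1 hx with hx | hx
    · obtain ⟨b, hb, rfl⟩ := Finset.mem_image.1 hx
      obtain ⟨j, -, rfl⟩ := exists_pow_eq_of_mem hσc hb₀ hb
      exact ⟨2 * j, cyc_even e σ b₀ j⟩
    · obtain ⟨b, hb, rfl⟩ := Finset.mem_image.1 hx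
      obtain ⟨j, -, rfl⟩ := exists_pow_eq_of_mem hσc hb₀ hb
      exact ⟨2 * j + 1, cyc_odd e σ b₀ j⟩

/-- Sites of the cycle lie in `V ∖ S`. [folklore] -/
theorem mem_sdiff_of_mem_cycSites {x : Site 2} (hx : x ∈ cycSites e σ) : x ∈ V \ S := by
  rcases Finset.mem_union.1 hx with hx | hx
  · obtain ⟨b, -, rfl⟩ := Finset.mem_image.1 hx
    exact (mem_blackPart.1 b.2).1
  · obtain ⟨b, -, rfl⟩ := Finset.mem_image.1 hx
    exact (mem_whitePart.1 (e b).2).1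

/-- A black site is on the cycle iff it is in the support. [folklore] -/
theorem black_mem_cycSites_iff (b : blackPart (V \ S)) : (b : Site 2) ∈ cycSites e σ ↔ b ∈ σ.support := by
  constructor
  · intro h
    rcases Finset.mem_union.1 h with h | h
    · obtain ⟨b', hb', hbb'⟩ := Finset.mem_image.1 h
      rwa [← Subtype.ext hbb']
    · obtain ⟨b', -, hbb'⟩ := Finset.mem_image.1 h
      exact absurd hbb'.symm (black_ne_white _ _)
  · exact fun h => Finset.mem_union_left _ (Finset.mem_image_of_mem _ h)

/-- A white site is on the cycle iff its `e`-preimage is in the support. [folklore] -/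
theorem white_mem_cycSites_iff (w : whitePart (V \ S)) : (w : Site 2) ∈ cycSites e σ ↔ e.symm w ∈ σ.support := by
  constructor
  · intro h
    rcases Finset.mem_union.1 h with h | h
    · obtain ⟨b', -, hbb'⟩ := Finset.mem_image.1 h
      exact absurd hbb' (black_ne_white _ _)
    · obtain ⟨b', hb', hbb'⟩ := Finset.mem_image.1 h
      have : e b' = w := Subtype.ext hbb'
      rwa [← this, Equiv.symm_apply_apply]
  · intro h
    refine Finset.mem_union_right _ (Finset.mem_image.2 ⟨_, h, ?_⟩)
    rw [Equiv.apply_symm_apply]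

/-! ### The alternating product along the superposition cycle -/

include hb₀ in
/-- **The ratio of the two terms along the cycle is the alternating Kasteleyn product of the
walk**: `∏_b K(b, e b) conj K(σ b, e b) = altProd`. [cite: Kenyon2009, §3.4] -/
theorem prod_eq_altProd :
    ∏ b : blackPart (V \ S), kasteleynWeight (b : Site 2) (e b : Site 2) *
        (starRingEnd ℂ) (kasteleynWeight ((σ b : blackPart (V \ S)) : Site 2) (e b : Site 2)) =
      (cycleWalk hF he hσc hσ (b₀ := b₀)).altProd := by
  set m := σ.support.card with hm
  have hzd1 : ∀ b : blackPart (V \ S), (zdGraph 2).Adj (b : Site 2) (e b : Site 2) := fun b =>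
    hF.zdGraph_adj (mem_of_black _) (mem_of_white _) (he b)
  have hzd2 : ∀ b : blackPart (V \ S), (zdGraph 2).Adj ((σ b : blackPart (V \ S)) : Site 2) (e b : Site 2) :=
    fun b => hF.zdGraph_adj (mem_of_black _) (mem_of_white _) (hσ b)
  -- restrict to the support
  rw [← Finset.prod_subset (Finset.subset_univ σ.support) fun b _ hb => by
    rw [Equiv.Perm.notMem_support.1 hb, kasteleynWeight_mul_conj (hzd1 b)]]
  -- reindex the support by the powers of `σ`
  have himage : σ.support = (Finset.range m).image fun j => (σ ^ j) b₀ := by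
    ext b
    constructor
    · intro hb
      obtain ⟨j, hj, rfl⟩ := exists_pow_eq_of_mem hσc hb₀ hb
      exact Finset.mem_image.2 ⟨j, Finset.mem_range.2 hj, rfl⟩
    · intro hb
      obtain ⟨j, -, rfl⟩ := Finset.mem_image.1 hb
      exact Equiv.Perm.pow_apply_mem_support.2 hb₀
  have hinj : ∀ j ∈ Finset.range m, ∀ j' ∈ Finset.range m, (σ ^ j) b₀ = (σ ^ j') b₀ → j = j' := by
    intro j hj j' hj' h
    have := (pow_apply_eq_iff hσc hb₀).1 h
    rwa [Nat.ModEq, Nat.mod_eq_of_lt (Finset.mem_range.1 hj), Nat.mod_eq_of_lt (Finset.mem_range.1 hj')] at this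
  rw [Finset.prod_congr himage fun _ _ => rfl, Finset.prod_image hinj,
    (cycleWalk hF he hσc hσ (b₀ := b₀)).altProd_eq_prod_pairs rfl]
  refine Finset.prod_congr rfl fun j _ => ?_
  -- the two weights of the `j`-th pair of steps
  have h1 : (cycleWalk hF he hσc hσ (b₀ := b₀)).wt (2 * j) =
      kasteleynWeight (((σ ^ j) b₀ : blackPart (V \ S)) : Site 2) (e ((σ ^ j) b₀) : Site 2) := by
    rw [ClosedWalk.wt, cycleWalk_v, cyc_odd, cyc_even, kasteleynWeight_eq_ite (hzd1 _)]
    rfl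
  have h2 : (cycleWalk hF he hσc hσ (b₀ := b₀)).wt (2 * j + 1) =
      kasteleynWeight ((σ ((σ ^ j) b₀) : blackPart (V \ S)) : Site 2) (e ((σ ^ j) b₀) : Site 2) := by
    rw [ClosedWalk.wt, cycleWalk_v, show 2 * j + 1 + 1 = 2 * (j + 1) by ring, cyc_even, cyc_odd,
      pow_succ', Equiv.Perm.mul_apply, kasteleynWeight_comm, kasteleynWeight_eq_ite ((hzd2 _).symm)]
    rfl
  rw [h1, h2]

/-! ### The steps and vertices of the cycle are edges and sites of `G` on `V` -/

/-- Every step of the superposition cycle is a `G`-edge between sites of `V`. [folklore] -/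
theorem cycleWalk_step (j : ℕ) : ∃ x ∈ V, ∃ y ∈ V, G.Adj x y ∧
    (cycleWalk hF he hσc hσ (b₀ := b₀)).v j = sitePair x ∧
      (cycleWalk hF he hσc hσ (b₀ := b₀)).v (j + 1) = sitePair y := by
  rw [cycleWalk_v]
  obtain ⟨i, rfl | rfl⟩ := Nat.even_or_odd' j
  · exact ⟨_, mem_of_black _, _, mem_of_white _, he _, cyc_even e σ b₀ i, cyc_odd e σ b₀ i⟩
  · refine ⟨_, mem_of_white _, _, mem_of_black _, (hσ ((σ ^ i) b₀)).symm, cyc_odd e σ b₀ i, ?_⟩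
    rw [show 2 * i + 1 + 1 = 2 * (i + 1) by ring, cyc_even, pow_succ', Equiv.Perm.mul_apply]

/-- Every vertex of the superposition cycle is a site of `V`. [folklore] -/
theorem cycleWalk_mem (j : ℕ) : ∃ x ∈ V, (cycleWalk hF he hσc hσ (b₀ := b₀)).v j = sitePair x := by
  obtain ⟨x, hx, -, -, -, h, -⟩ := cycleWalk_step hF he hσc hσ (b₀ := b₀) j
  exact ⟨x, hx, h⟩

/-! ### The pairing of `V` off the cycle: the matching of `S` and the reference matching `e` -/

variable (fS : ↥((S : Finset (Site 2)) : Set (Site 2)) → ↥((S : Finset (Site 2)) : Set (Site 2)))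
  (hfS : ∀ v, (G.induce ((S : Finset (Site 2)) : Set (Site 2))).Adj v (fS v) ∧ fS (fS v) = v)

/-- **The pairing of the sites of `V`**: the partner in the perfect matching of `S` for sites of
`S`, the `e`-partner for sites of `V ∖ S` (junk: the identity elsewhere). [cite: Kenyon2009, §3.4] -/
def pairing (e : blackPart (V \ S) ≃ whitePart (V \ S))
    (fS : ↥((S : Finset (Site 2)) : Set (Site 2)) → ↥((S : Finset (Site 2)) : Set (Site 2))) (x : Site 2) : Site 2 :=
  if hxS : x ∈ S then (fS ⟨x, hxS⟩ : Site 2)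
  else if hxU : x ∈ V \ S then
    (if hw : IsWhite x then ((e.symm ⟨x, mem_whitePart.2 ⟨hxU, hw⟩⟩ : blackPart (V \ S)) : Site 2)
      else ((e ⟨x, mem_blackPart.2 ⟨hxU, hw⟩⟩ : whitePart (V \ S)) : Site 2))
  else x

variable {fS}

/-- The pairing on `S`. [folklore] -/
theorem pairing_of_mem {x : Site 2} (hx : x ∈ S) : pairing e fS x = fS ⟨x, hx⟩ := by
  simp [pairing, hx]

/-- The pairing on white sites of `V ∖ S`. [folklore] -/
theorem pairing_of_isWhite {x : Site 2} (hx : x ∈ V \ S) (hw : IsWhite x) :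
    pairing e fS x = ((e.symm ⟨x, mem_whitePart.2 ⟨hx, hw⟩⟩ : blackPart (V \ S)) : Site 2) := by
  have hxS : x ∉ S := (Finset.mem_sdiff.1 hx).2
  simp [pairing, hxS, hx, hw]

/-- The pairing on black sites of `V ∖ S`. [folklore] -/
theorem pairing_of_not_isWhite {x : Site 2} (hx : x ∈ V \ S) (hw : ¬ IsWhite x) :
    pairing e fS x = ((e ⟨x, mem_blackPart.2 ⟨hx, hw⟩⟩ : whitePart (V \ S)) : Site 2) := by
  have hxS : x ∉ S := (Finset.mem_sdiff.1 hx).2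
  simp [pairing, hxS, hx, hw]

include he hfS in
/-- The pairing maps `V` to `V`, is adjacent, and is an involution. [folklore] -/
theorem pairing_spec (hS : S ⊆ V) {x : Site 2} (hx : x ∈ V) :
    pairing e fS x ∈ V ∧ G.Adj x (pairing e fS x) ∧ pairing e fS (pairing e fS x) = x := by
  by_cases hxS : x ∈ S
  · rw [pairing_of_mem hxS]
    have h1 : ((fS ⟨x, hxS⟩ : ↥((S : Finset (Site 2)) : Set (Site 2))) : Site 2) ∈ S := (fS ⟨x, hxS⟩).2
    refine ⟨hS h1, SimpleGraph.induce_adj.1 (hfS ⟨x, hxS⟩).1, ?_⟩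
    rw [pairing_of_mem h1]
    have := congrArg Subtype.val (hfS ⟨x, hxS⟩).2
    exact this
  · have hxU : x ∈ V \ S := Finset.mem_sdiff.2 ⟨hx, hxS⟩
    by_cases hw : IsWhite x
    · rw [pairing_of_isWhite hxU hw]
      set b := e.symm ⟨x, mem_whitePart.2 ⟨hxU, hw⟩⟩ with hb
      have hbU : (b : Site 2) ∈ V \ S := (mem_blackPart.1 b.2).1
      refine ⟨mem_of_black b, ?_, ?_⟩
      · have := he b
        rw [hb, Equiv.apply_symm_apply] at this
        exact this.symm
      · rw [pairing_of_not_isWhite hbU (mem_blackPart.1 b.2).2]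
        have : (⟨(b : Site 2), mem_blackPart.2 ⟨hbU, (mem_blackPart.1 b.2).2⟩⟩ : blackPart (V \ S)) = b :=
          Subtype.ext rfl
        rw [this, hb, Equiv.apply_symm_apply]
    · rw [pairing_of_not_isWhite hxU hw]
      set w := e ⟨x, mem_blackPart.2 ⟨hxU, hw⟩⟩ with hw'
      have hwU : (w : Site 2) ∈ V \ S := (mem_whitePart.1 w.2).1
      refine ⟨mem_of_white w, he ⟨x, mem_blackPart.2 ⟨hxU, hw⟩⟩, ?_⟩
      rw [pairing_of_isWhite hwU (mem_whitePart.1 w.2).2]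
      have : (⟨(w : Site 2), mem_whitePart.2 ⟨hwU, (mem_whitePart.1 w.2).2⟩⟩ : whitePart (V \ S)) = w :=
        Subtype.ext rfl
      rw [this, hw', Equiv.symm_apply_apply]

/-- **The cycle is closed under the pairing**: a site of `V` is on the cycle iff its partner is.
[cite: Kenyon2009, §3.4] -/
theorem pairing_mem_cycSites_iff {x : Site 2} (hx : x ∈ V) :
    pairing e fS x ∈ cycSites e σ ↔ x ∈ cycSites e σ := by
  by_cases hxS : x ∈ S
  · rw [pairing_of_mem hxS]
    have h1 : ((fS ⟨x, hxS⟩ : ↥((S : Finset (Site 2)) : Set (Site 2))) : Site 2) ∈ S := (fS ⟨x, hxS⟩).2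
    constructor
    · exact fun h => absurd h1 (Finset.mem_sdiff.1 (mem_sdiff_of_mem_cycSites h)).2
    · exact fun h => absurd hxS (Finset.mem_sdiff.1 (mem_sdiff_of_mem_cycSites h)).2
  · have hxU : x ∈ V \ S := Finset.mem_sdiff.2 ⟨hx, hxS⟩
    by_cases hw : IsWhite x
    · rw [pairing_of_isWhite hxU hw, black_mem_cycSites_iff]
      have := white_mem_cycSites_iff (e := e) (σ := σ) ⟨x, mem_whitePart.2 ⟨hxU, hw⟩⟩
      exact this.symm
    · rw [pairing_of_not_isWhite hxU hw, white_mem_cycSites_iff, Equiv.symm_apply_apply]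
      exact (black_mem_cycSites_iff (e := e) ⟨x, mem_blackPart.2 ⟨hxU, hw⟩⟩).symm

/-! ### The winding numbers off the cycle have even sum -/

include hb₀ hfS in
/-- **"`ℓ` is even since interior points are matched among themselves"** (Kenyon 2009, proof of
Thm 2), in winding form: the winding numbers of the lattice points off the superposition cycle
(in a box containing `V`) have even sum. Points with non-zero winding number are sites of `V`
(enclosed faces are faces of `F`, the face union being simply connected), and off the cycle the
pairing of `V` matches lattice neighbours, which have equal winding numbers. [cite: Kenyon2009, §3.4] -/
theorem even_sum_W (hsc : IsSimplyConnected (faceUnion F)) (hS : S ⊆ V) {P₀ P₁ Q₀ Q₁ : ℤ}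
    (hbox : ∀ x ∈ V, P₀ ≤ x 0 ∧ x 0 ≤ P₁ ∧ Q₀ ≤ x 1 ∧ x 1 ≤ Q₁) :
    Even (∑ u ∈ (Finset.Icc P₀ P₁ ×ˢ Finset.Icc Q₀ Q₁).filter
      (fun u => u ∉ (cycleWalk hF he hσc hσ (b₀ := b₀)).verts), (cycleWalk hF he hσc hσ (b₀ := b₀)).W u) := by
  set c := cycleWalk hF he hσc hσ (b₀ := b₀) with hcdef
  set B := Finset.Icc P₀ P₁ ×ˢ Finset.Icc Q₀ Q₁ with hB
  have hm : 0 < 2 * σ.support.card := by have := Finset.card_pos.2 ⟨b₀, hb₀⟩; omega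
  have hverts : ∀ x : Site 2, sitePair x ∈ c.verts ↔ x ∈ cycSites e σ := fun x => by
    rw [hcdef, mem_verts_cycleWalk_iff hF he hσc hσ hb₀]
    exact ⟨fun ⟨x', hx', h⟩ => sitePair_injective h ▸ hx', fun h => ⟨x, h, rfl⟩⟩
  have hnot : ∀ x : Site 2, x ∉ cycSites e σ → ∀ j, c.v j ≠ sitePair x := fun x hx j hj =>
    hx ((hverts x).1 ((c.mem_verts_iff hm).2 ⟨j, hj⟩))
  -- the sites of `V` off the cycle with non-zero winding number
  set V' := V.filter (fun x => x ∉ cycSites e σ ∧ c.W (sitePair x) ≠ 0) with hV'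
  have hsum : ∑ u ∈ B.filter (fun u => u ∉ c.verts), c.W u = ∑ x ∈ V', c.W (sitePair x) := by
    rw [← Finset.sum_filter_ne_zero (B.filter fun u => u ∉ c.verts)]
    symm
    refine Finset.sum_nbij sitePair (fun x hx => ?_) (sitePair_injective.injOn) (fun u hu => ?_)
      (fun _ _ => rfl)
    · obtain ⟨hxV, hxc, hW⟩ := Finset.mem_filter.1 hx
      obtain ⟨h1, h2, h3, h4⟩ := hbox x hxV
      simp only [Finset.mem_filter, hB, Finset.mem_product, Finset.mem_Icc]
      exact ⟨⟨⟨⟨h1, h2⟩, h3, h4⟩, fun h => hxc ((hverts x).1 h)⟩, hW⟩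
    · simp only [Finset.coe_filter, Set.mem_setOf_eq, Finset.mem_filter] at hu
      obtain ⟨⟨-, huc⟩, hW⟩ := hu
      obtain ⟨a, haV, rfl⟩ := exists_mem_of_W_ne_zero hF hsc hm c (cycleWalk_step hF he hσc hσ) hW
      refine ⟨a, ?_, rfl⟩
      simp only [Finset.coe_filter, Set.mem_setOf_eq, hV']
      exact ⟨haV, fun h => huc ((hverts a).2 h), hW⟩
  rw [hsum]
  -- pair off `V'` by the pairing: the sum vanishes mod 2
  have hW : ∀ x ∈ V', c.W (sitePair (pairing e fS x)) = c.W (sitePair x) := by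
    intro x hx
    obtain ⟨hxV, hxc, -⟩ := Finset.mem_filter.1 hx
    obtain ⟨hpV, hadj, -⟩ := pairing_spec he hfS hS hxV
    refine (c.W_eq_of_notMem (hnot x hxc) (hnot _ fun h => hxc ?_)
      (adj_sitePair (hF.zdGraph_adj hxV hpV hadj))).symm
    exact (pairing_mem_cycSites_iff (e := e) (fS := fS) (σ := σ) hxV).1 h
  have hz : ∑ x ∈ V', (c.W (sitePair x) : ZMod 2) = 0 := by
    refine Finset.sum_involution (fun x _ => pairing e fS x) (fun x hx => ?_) (fun x hx _ => ?_)
      (fun x hx => ?_) (fun x hx => ?_)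
    · rw [hW x hx]
      exact CharTwo.add_self_eq_zero _
    · obtain ⟨hxV, -, -⟩ := Finset.mem_filter.1 hx
      exact ((pairing_spec he hfS hS hxV).2.1).ne'
    · obtain ⟨hxV, hxc, hWx⟩ := Finset.mem_filter.1 hx
      refine Finset.mem_filter.2 ⟨(pairing_spec he hfS hS hxV).1, fun h => hxc ?_, by rwa [hW x hx]⟩
      exact (pairing_mem_cycSites_iff (e := e) (fS := fS) (σ := σ) hxV).1 h
    · obtain ⟨hxV, -, -⟩ := Finset.mem_filter.1 hx
      exact (pairing_spec he hfS hS hxV).2.2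
  have hz' : (((∑ x ∈ V', c.W (sitePair x) : ℤ)) : ZMod 2) = 0 := by push_cast; exact hz
  have hdvd := (ZMod.intCast_zmod_eq_zero_iff_dvd _ 2).1 hz'
  exact even_iff_two_dvd.2 (by exact_mod_cast hdvd)

/-! ### Sign coherence -/

/-- A box containing the finite set `V`. [folklore] -/
theorem exists_box (V : Finset (Site 2)) :
    ∃ P₀ P₁ Q₀ Q₁ : ℤ, ∀ x ∈ V, P₀ ≤ x 0 ∧ x 0 ≤ P₁ ∧ Q₀ ≤ x 1 ∧ x 1 ≤ Q₁ := by
  obtain ⟨P₀, hP₀⟩ := (V.image fun x : Site 2 => x 0).bddBelow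
  obtain ⟨P₁, hP₁⟩ := (V.image fun x : Site 2 => x 0).bddAbove
  obtain ⟨Q₀, hQ₀⟩ := (V.image fun x : Site 2 => x 1).bddBelow
  obtain ⟨Q₁, hQ₁⟩ := (V.image fun x : Site 2 => x 1).bddAbove
  refine ⟨P₀, P₁, Q₀, Q₁, fun x hx => ⟨hP₀ ?_, hP₁ ?_, hQ₀ ?_, hQ₁ ?_⟩⟩ <;>
    exact Finset.mem_coe.2 (Finset.mem_image_of_mem _ hx)

include hF he hσc hσ hfS in
/-- **Sign coherence for a cycle** (the heart of Kasteleyn's theorem): for a cyclic adjacent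
permutation `σ` of the blacks, `sgn σ = ∏_b K(b, e b) conj K(σ b, e b)`, i.e. changing the
reference matching along one superposition cycle of length `2k` changes the term by the sign
`(-1)^{k+1}` of the `k`-cycle (Kenyon 2009, proof of Thm 2, with Lemma 1). [cite: Kenyon2009, §3.4 (proof of Thm 2)] -/
theorem sign_eq_prod_of_isCycle (hsc : IsSimplyConnected (faceUnion F)) (hS : S ⊆ V) :
    ((Equiv.Perm.sign σ : ℤ) : ℂ) =
      ∏ b : blackPart (V \ S), kasteleynWeight (b : Site 2) (e b : Site 2) *
        (starRingEnd ℂ) (kasteleynWeight ((σ b : blackPart (V \ S)) : Site 2) (e b : Site 2)) := by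
  obtain ⟨b₀, hb₀⟩ := hσc.nonempty_support
  have hm2 := hσc.two_le_card_support
  obtain ⟨P₀, P₁, Q₀, Q₁, hbox⟩ := exists_box V
  set c := cycleWalk hF he hσc hσ (b₀ := b₀) with hcdef
  have hX : ∀ j, P₀ ≤ (c.v j).1 ∧ (c.v j).1 ≤ P₁ := fun j => by
    obtain ⟨x, hx, h⟩ := cycleWalk_mem hF he hσc hσ (b₀ := b₀) j
    rw [hcdef, h]
    exact ⟨(hbox x hx).1, (hbox x hx).2.1⟩
  have hY : ∀ j, Q₀ ≤ (c.v j).2 ∧ (c.v j).2 ≤ Q₁ := fun j => by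
    obtain ⟨x, hx, h⟩ := cycleWalk_mem hF he hσc hσ (b₀ := b₀) j
    rw [hcdef, h]
    exact ⟨(hbox x hx).2.2.1, (hbox x hx).2.2.2⟩
  have hev := even_sum_W hF he hσc hσ hb₀ hfS hsc hS hbox
  have key := c.altProd_eq_of_even (cycleWalk_simple hF he hσc hσ hb₀) rfl (by omega) hX hY hev
  rw [prod_eq_altProd hF he hσc hσ hb₀, ← hcdef, key, hσc.sign]
  simp [Units.val_pow_eq_pow_val]

include hF he hfS in
/-- **Sign coherence** (Kenyon 1997, Thm 2: "each term has the same sign"): for every adjacent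
permutation `σ` of the blacks of `V ∖ S` (with an adjacent reference identification `e`),
`sgn σ = ∏_b K(b, e b) conj K(σ b, e b)`. By induction on the cycle decomposition of `σ`
(`Equiv.Perm.cycle_induction_on`), the cycle case being `sign_eq_prod_of_isCycle`.
[cite: Kenyon1997, Thm 2 (proof sketch)] -/
theorem sign_eq_prod (hsc : IsSimplyConnected (faceUnion F)) (hS : S ⊆ V)
    (τ : Equiv.Perm (blackPart (V \ S))) (hτ : AdjAll G e τ) :
    ((Equiv.Perm.sign τ : ℤ) : ℂ) =
      ∏ b : blackPart (V \ S), kasteleynWeight (b : Site 2) (e b : Site 2) *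
        (starRingEnd ℂ) (kasteleynWeight ((τ b : blackPart (V \ S)) : Site 2) (e b : Site 2)) := by
  have hzd1 : ∀ b : blackPart (V \ S), (zdGraph 2).Adj (b : Site 2) (e b : Site 2) := fun b =>
    hF.zdGraph_adj (mem_of_black _) (mem_of_white _) (he b)
  revert hτ
  refine Equiv.Perm.cycle_induction_on
    (P := fun τ : Equiv.Perm (blackPart (V \ S)) => AdjAll G e τ → ((Equiv.Perm.sign τ : ℤ) : ℂ) =
      ∏ b : blackPart (V \ S), kasteleynWeight (b : Site 2) (e b : Site 2) *
        (starRingEnd ℂ) (kasteleynWeight ((τ b : blackPart (V \ S)) : Site 2) (e b : Site 2))) τ ?_ ?_ ?_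
  · intro _
    rw [Equiv.Perm.sign_one, Finset.prod_eq_one fun b _ => ?_]
    · simp
    · rw [Equiv.Perm.one_apply]
      exact kasteleynWeight_mul_conj (hzd1 b)
  · intro σ hσc hσ
    exact sign_eq_prod_of_isCycle hF he hσc hσ hfS hsc hS
  · intro σ τ hd hσc ihσ ihτ hστ
    have hσ : AdjAll G e σ := fun b => by
      rcases hd b with h | h
      · rw [h]; exact he b
      · have := hστ b
        rwa [Equiv.Perm.mul_apply, h] at this
    have hτ : AdjAll G e τ := fun b => by
      rcases hd (τ b) with h | h
      · have := hστ b
        rwa [Equiv.Perm.mul_apply, h] at this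
      · rw [τ.injective h]; exact he b
    rw [Equiv.Perm.sign_mul, Units.val_mul, Int.cast_mul, ihσ hσ, ihτ hτ, ← Finset.prod_mul_distrib]
    refine Finset.prod_congr rfl fun b _ => ?_
    rw [Equiv.Perm.mul_apply]
    rcases hd b with h | h
    · -- `σ b = b`
      by_cases ht : τ b = b
      · rw [ht, h, kasteleynWeight_mul_conj (hzd1 b), one_mul]
      · have hστb : σ (τ b) = τ b := by
          rcases hd (τ b) with h' | h'
          · exact h'
          · exact absurd (τ.injective h') ht
        rw [hστb, h, kasteleynWeight_mul_conj (hzd1 b), one_mul]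
    · -- `τ b = b`
      rw [h, kasteleynWeight_mul_conj (hzd1 b), mul_one]

end Cycle

/-! ### Assembly -/

section Assembly

variable {G : SimpleGraph (Site 2)} {V S F : Finset (Site 2)}

/-- **Kasteleyn's count for `V ∖ S`** when an adjacent reference identification `e` exists:
`‖det B'‖ = #adjacency bijections`. [cite: Kenyon1997, Prop 5 and Thm 2 (§3 ¶1 for dominos)] -/
theorem norm_det_submatrix_eq_card (hF : IsFaceSkeleton G V F) (hsc : IsSimplyConnected (faceUnion F))
    (hS : S ⊆ V) (hSm : ∃ M : (G.induce (S : Set (Site 2))).Subgraph, M.IsPerfectMatching)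
    (β₀ : BWBij G (V \ S)) :
    ‖((kasteleynBW G (V \ S)).submatrix id β₀.1).det‖ = Nat.card (BWBij G (V \ S)) := by
  obtain ⟨M, hM⟩ := hSm
  obtain ⟨fS, hfS⟩ := perfectMatchingEquivPartner _ ⟨M, hM⟩
  have he := β₀.2
  have hzd1 : ∀ b : blackPart (V \ S), (zdGraph 2).Adj (b : Site 2) (β₀.1 b : Site 2) := fun b =>
    hF.zdGraph_adj (mem_of_black _) (mem_of_white _) (he b)
  refine norm_det_submatrix_of_coherent β₀.1 hzd1 fun σ hσ => ?_
  rw [sign_eq_prod hF he hfS hsc hS σ hσ, omega, omega, ← Finset.prod_mul_distrib]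
  refine Finset.prod_congr rfl fun b _ => ?_
  rw [Equiv.Perm.one_apply, mul_assoc, mul_comm ((starRingEnd ℂ) _), kasteleynWeight_mul_conj, mul_one]
  exact hF.zdGraph_adj (mem_of_black _) (mem_of_white _) (hσ b)

end Assembly

end Kasteleyn

open Kasteleyn in
/-- **Kenyon 1997, Prop. 5 with Thm 2 (Kasteleyn's theorem for dominos on a simply connected
region, after deleting the vertices of a partial matching): the named fact `Kenyon1997_prop5`
holds.** For `G` on `V` a balanced simply connected face skeleton and `S ⊆ V` carrying a perfect
matching of `G`, `‖det (kasteleynMatrix G (V ∖ S))‖ = (perfectMatchingCount G ↑(V ∖ S))²`.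
Proof: `‖det K‖ = ‖det B'‖²` (`norm_det_kasteleynMatrix_eq_sq`); the terms of `det B'` are the
adjacency bijections = perfect matchings (`perfectMatchingCount_eq_card`), all of the same unit
value by sign coherence (`sign_eq_prod`, Kasteleyn's sign lemma on the superposition cycles,
whose enclosed points are in `V` by simple connectivity and evenly paired off the cycle);
degenerate cases (unbalanced `V ∖ S`, no matching) give `0 = 0`.
[cite: Kenyon1997, Prop 5 and Thm 2 (§3 ¶1 for dominos)] -/
theorem Kenyon1997_prop5_holds : Kenyon1997_prop5 := by
  intro G V S hV _hbal hS hSm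
  obtain ⟨F, hF, hsc⟩ := hV
  have hUV : V \ S ⊆ V := Finset.sdiff_subset
  have hGV : ∀ ⦃x y : Site 2⦄, x ∈ V \ S → y ∈ V \ S → G.Adj x y → (zdGraph 2).Adj x y :=
    fun x y hx hy h => hF.zdGraph_adj (hUV hx) (hUV hy) h
  have hbip : ∀ ⦃x y : Site 2⦄, x ∈ V \ S → y ∈ V \ S → G.Adj x y → (IsWhite x ↔ ¬ IsWhite y) :=
    fun x y hx hy h => isWhite_iff_not_isWhite_of_adj (hGV hx hy h)
  by_cases hcard : #(blackPart (V \ S)) = #(whitePart (V \ S))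
  swap
  · rw [det_kasteleynMatrix_eq_zero_of_card_ne G hcard, perfectMatchingCount_eq_zero_of_card_ne hGV hcard]
    simp
  rw [perfectMatchingCount_eq_card hbip]
  by_cases hne : Nonempty (BWBij G (V \ S))
  · obtain ⟨β₀⟩ := hne
    rw [norm_det_kasteleynMatrix_eq_sq G (V \ S) β₀.1, norm_det_submatrix_eq_card hF hsc hS hSm β₀]
  · -- no adjacency bijection: no matching, and every term of `det B'` vanishes
    have hempty : IsEmpty (BWBij G (V \ S)) := not_nonempty_iff.1 hne
    have e : blackPart (V \ S) ≃ whitePart (V \ S) := Fintype.equivOfCardEq (by simpa using hcard)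
    rw [norm_det_kasteleynMatrix_eq_sq G (V \ S) e, det_submatrix_eq e, Nat.card_of_isEmpty]
    have hT : (Finset.univ : Finset (Equiv.Perm (blackPart (V \ S)))).filter (AdjAll G e) = ∅ := by
      rw [Finset.filter_eq_empty_iff]
      intro σ _ hσ
      exact hempty.false (adjAllEquivBW e ⟨σ, hσ⟩)
    rw [hT]
    simp

end Literature.Probability.LatticeModels

end
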